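import Mathlib
import HarnessLib
import Summits.ResolutionOfSingularities.ResolutionOfSingularities.Theorems.WildQuotientsWildQuotientResolutionKSGoingDownExceptionalPrime
import Summits.ResolutionOfSingularities.ResolutionOfSingularities.Theorems.WildQuotientsWildQuotientResolutionKSGoingDownLocalStep

/-!
# Kollár–Szabó going down: packaging a local ring with residue-trivial action as the data of the local
# blow-up step (crux `WildQuotients.WildQuotientResolution`, stub `stub_phaseZeroHighDim`)

Crux stmt-ResolutionOfSingularities-15640 (`WildQuotientResolution`), registered stub `stub_phaseZeroHighDim`;
programme: `KollarSzaboGoingDown_holds` via ✓`kollarSzaboGoingDown_of_localStepLE` (p828458), whose local step is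
to be supplied by `Spec` of the equivariant quadratic transform `R₁` (✓`EigenlineChart.exists_equivariant_quadraticTransform`,
hand 8-g1). This file provides the `Spec`-side clauses of that step for an ABSTRACT local ring `R` with an action
`ρ g = Spec (g⁻¹)` of `G` (tree convention, ✓`AffineQuotient.exists_specAction`):

* `mem_inertiaSubgroup_closedPoint_of_residueTrivial` — if the action is RESIDUE-TRIVIAL (`g • r - r ∈ 𝔪`), every
  `g` lies in the inertia group of the closed point of `Spec R` (clause `H ≤ I_{x₁}`);
* `stalkClosedPointEquiv` is NOT defined (def-free file); instead `exists_ringEquiv_stalk_closedPoint` — the stalk of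
  `Spec R` at the closed point is ring-isomorphic to `R` — and its consequences
  `isRegularLocalRing_stalk_closedPoint`, `ringKrullDim_stalk_closedPoint`, `isAlgClosed_residueField_stalk_closedPoint`
  (clauses "`𝒪_{E,x₁}` regular of dimension `≤ n` with algebraically closed residue field" for `E = Spec (R₁/(t))`);
* `valuationRing_stalk_spanSingleton` — for `R` regular local and `t ∈ 𝔪 ∖ 𝔪²`, the stalk of `Spec R` at the point
  `(t)` is a valuation ring (clause `η`), from ✓`valuationRing_localization_span_singleton` and ✓`valuationRing_stalk_spec`.

[OURS · crux stmt-ResolutionOfSingularities-15640 · helper toward `stub_phaseZeroHighDim` ((K2)-scheme packaging; NOT a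
proof of the stub); counted 0; AI-level work, weaker than expert review.] [folklore]
-/

-- single-problem summit: the doubled namespace component `ResolutionOfSingularities` is forced
set_option linter.dupNamespace false

noncomputable section

open CategoryTheory AlgebraicGeometry TopologicalSpace IsLocalRing
open Literature.AlgebraicGeometry.Ramification

namespace Summit.ResolutionOfSingularities.ResolutionOfSingularities.Theorems.WildQuotientResolution.KSGoingDown

universe u v

section ClosedPoint

variable {R : Type u} [CommRing R] [IsLocalRing R]

/-- **Residue-trivial actions fix the closed point inertially**: for `ρ g = Spec (g⁻¹)` on `Spec R` (`R` local)
and `g • r - r ∈ 𝔪` for all `r`, `g ∈ I_{𝔪}` (apply ✓`mem_inertiaSubgroup_specMap_of_invariant` to the residue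
map `R → κ(R)`). [folklore] -/
theorem mem_inertiaSubgroup_closedPoint_of_residueTrivial {G : Type v} [Group G] [MulSemiringAction G R]
    (ρ : G →* Aut (Spec (.of R)))
    (hρ : ∀ g, (ρ g).hom =
      Spec.map (CommRingCat.ofHom ((MulSemiringAction.toRingEquiv G R g⁻¹ : R ≃+* R) : R →+* R)))
    (g : G) (hres : ∀ r : R, g • r - r ∈ maximalIdeal R) :
    g ∈ inertiaSubgroup ρ (closedPoint R) := by
  have hφ : ∀ r : R, residue R (g • r) = residue R r := fun r => by
    rw [← sub_eq_zero, ← map_sub, residue_eq_zero_iff]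
    exact hres r
  have key := mem_inertiaSubgroup_specMap_of_invariant ρ hρ (residue R) g hφ
  have hpt : (Spec.map (CommRingCat.ofHom (residue R))).base (closedPoint (ResidueField R)) =
      closedPoint R := by
    apply PrimeSpectrum.ext
    rw [specMap_base_closedPoint_asIdeal]
    exact ker_residue
  rwa [hpt] at key

/-- **The stalk of `Spec R` at the closed point is `R`** (`R` local): the localisation at `𝔪` inverts only units.
[folklore] -/
theorem exists_ringEquiv_stalk_closedPoint :
    Nonempty (R ≃+* (Spec (CommRingCat.of R)).presheaf.stalk (closedPoint R)) := by
  have hM : (closedPoint R).asIdeal.primeCompl ≤ IsUnit.submonoid R := by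
    intro r hr
    exact (IsLocalRing.notMem_maximalIdeal).mp hr
  exact ⟨(IsLocalization.atUnits R (closedPoint R).asIdeal.primeCompl
    (S := (Spec.structureSheaf R).presheaf.stalk (closedPoint R)) hM).toRingEquiv⟩

/-- The stalk of `Spec R` at the closed point has the Krull dimension of `R`. [folklore] -/
theorem ringKrullDim_stalk_closedPoint :
    ringKrullDim ((Spec (CommRingCat.of R)).presheaf.stalk (closedPoint R)) = ringKrullDim R := by
  obtain ⟨e⟩ := exists_ringEquiv_stalk_closedPoint (R := R)
  exact (ringKrullDim_eq_of_ringEquiv e).symm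

/-- The residue field of the stalk of `Spec R` at the closed point is algebraically closed when `κ(R)` is.
[folklore] -/
theorem isAlgClosed_residueField_stalk_closedPoint [IsAlgClosed (ResidueField R)] :
    IsAlgClosed (ResidueField ((Spec (CommRingCat.of R)).presheaf.stalk (closedPoint R))) := by
  obtain ⟨e⟩ := exists_ringEquiv_stalk_closedPoint (R := R)
  exact IsAlgClosed.of_ringEquiv (ResidueField R) _ (ResidueField.mapEquiv e)

end ClosedPoint

/-- The stalk of `Spec R` at the closed point is a regular local ring when `R` is. [folklore] -/
theorem isRegularLocalRing_stalk_closedPoint {R : Type u} [CommRing R] [IsRegularLocalRing R] :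
    IsRegularLocalRing ((Spec (CommRingCat.of R)).presheaf.stalk (closedPoint R)) := by
  obtain ⟨e⟩ := exists_ringEquiv_stalk_closedPoint (R := R)
  exact IsRegularLocalRing.of_ringEquiv e


section ExceptionalPoint

variable {S : Type u} [CommRing S] [IsRegularLocalRing S] [IsDomain S] {t : S}

/-- **The exceptional point `η = (t) ∈ Spec S₁` has a valuation ring as local ring** (`S₁` regular local,
`t ∈ 𝔪 ∖ 𝔪²`): clause `η` of the local blow-up step. [folklore] -/
theorem valuationRing_stalk_spanSingleton (ht : t ∈ maximalIdeal S) (ht2 : t ∉ (maximalIdeal S) ^ 2) :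
    ValuationRing ((Spec (CommRingCat.of S)).presheaf.stalk
      (⟨Ideal.span {t}, isPrime_span_singleton_of_not_mem_sq ht ht2⟩ : PrimeSpectrum S)) := by
  haveI hp : (Ideal.span {t}).IsPrime := isPrime_span_singleton_of_not_mem_sq ht ht2
  haveI := valuationRing_localization_span_singleton ht ht2 (hp := hp)
  exact valuationRing_stalk_spec (R := S) ⟨Ideal.span {t}, hp⟩

omit [IsDomain S] in
/-- The exceptional point lies in the image of `Spec (S/(t)) → Spec S` (it is the image of the generic point).
[folklore] -/
theorem spanSingleton_mem_range_specMap_quotient (ht : t ∈ maximalIdeal S)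
    (ht2 : t ∉ (maximalIdeal S) ^ 2) :
    (⟨Ideal.span {t}, isPrime_span_singleton_of_not_mem_sq ht ht2⟩ : PrimeSpectrum S) ∈
      Set.range (Spec.map (CommRingCat.ofHom (Ideal.Quotient.mk (Ideal.span {t})))).base := by
  haveI hp : (Ideal.span {t}).IsPrime := isPrime_span_singleton_of_not_mem_sq ht ht2
  haveI : IsDomain (S ⧸ Ideal.span {t}) := (Ideal.Quotient.isDomain_iff_prime _).mpr hp
  refine ⟨(⟨⊥, Ideal.isPrime_bot⟩ : PrimeSpectrum (S ⧸ Ideal.span {t})), ?_⟩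
  apply PrimeSpectrum.ext
  change Ideal.comap (Ideal.Quotient.mk (Ideal.span {t})) ⊥ = Ideal.span {t}
  rw [← RingHom.ker_eq_comap_bot, Ideal.mk_ker]

end ExceptionalPoint

end Summit.ResolutionOfSingularities.ResolutionOfSingularities.Theorems.WildQuotientResolution.KSGoingDown

end
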